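import Summits.Ventures.PercRepro.LemmaBPlusK5Def

/-!
# Faces of `K₅`: kernel slices 16 … 19 (part E)

Each theorem is one `decide +kernel` at default heartbeats (≈ 55 s: the 1024-row table of the marking
plus ≤ 22 000 face points in sub-mask loops); generated by `tools/gen_k5.py`.
-/

namespace PercRepro

namespace Examples

open MultiGraph

/-- Slice 16: joins `u ∈ [687, 703)` of the faces of `K₅` (16362 face points). -/
theorem k5_slice_16 : k5.FacesSRange ![0, 1, 2, 3] 687 703 := by decide +kernel

/-- Slice 17: joins `u ∈ [703, 731)` of the faces of `K₅` (20358 face points). -/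
theorem k5_slice_17 : k5.FacesSRange ![0, 1, 2, 3] 703 731 := by decide +kernel

/-- Slice 18: joins `u ∈ [731, 747)` of the faces of `K₅` (20736 face points). -/
theorem k5_slice_18 : k5.FacesSRange ![0, 1, 2, 3] 731 747 := by decide +kernel

/-- Slice 19: joins `u ∈ [747, 758)` of the faces of `K₅` (20655 face points). -/
theorem k5_slice_19 : k5.FacesSRange ![0, 1, 2, 3] 747 758 := by decide +kernel

end Examples

end PercRepro
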